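import Literature.NumberTheory.EllipticCurves.CongruentNumberMonskySelmerParityEven
import Literature.NumberTheory.EllipticCurves.CongruentNumberOddMonskySelmerExact
import Literature.NumberTheory.EllipticCurves.CongruentNumberEvenMonskySelmerExact
import Literature.NumberTheory.EllipticCurves.CongruentNumberMonskySelmerRankBound
import Literature.NumberTheory.EllipticCurves.CasselsTateParity
import Literature.Algebra.Module.AlternatingPairingParity
import Literature.NumberTheory.EllipticCurves.BSDAnalyticRankProofs
import HarnessLib

/-!
# Monsky's parity theorem for `s(D)` — part 5: the `2`-Selmer group of `E_D`, and the parity of the rank granting Cassels–Tate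

P. Monsky's appendix to D. R. Heath-Brown, Invent. Math. **118** (1994) [HeathBrown1994SelmerCongruentII]
proves (typescript p. 38 L5–L7) that `s(D)` — defined by `#Sel⁽²⁾(E_D/ℚ) = 2^{2+s(D)}`,
`E_D : y² = x³ − D²x` (Heath-Brown §1, p. 1 L17–L18) — is even for square-free `D ≡ 1, 2, 3 (mod 8)`
and odd for `D ≡ 5, 6, 7 (mod 8)` ("the parity condition", §1 p. 3 L13–L16).  Parts 1–4 of this series
prove it for Monsky's matrix rank (`even_monskySelmerRankOdd_iff`, `even_monskySelmerRankEven_iff`);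
the `2`-Selmer formula itself is the tree theorem `HeathBrown1994.monsky_card_selmerGroup_two_{odd,even}_holds`
(a complete `2`-descent, `CongruentNumber{Odd,Even}MonskySelmerExact`).  This file states the
consequences for the curve, for EVERY square-free `D` (no enumeration of prime factors in the
statements):

* §1 `exists_prime_family_of_squarefree` — a square-free `N` is `p₁⋯p_k` for an injective family of
  primes (the printed "`p₁, …, p_n` are the primes dividing `D`", p. 39 L7–L8), odd ones if `N` is odd;
* §2 **the parity condition for the `2`-Selmer group** (`exists_card_selmerGroup_two_eq_pow`): for
  square-free `N` there is `s` with `#Sel⁽²⁾(E_N/ℚ) = 2^{2+s}`, `rk E_N(ℚ) ≤ s`, and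
  `s` even iff `N ≡ 1, 2, 3 (mod 8)` — UNCONDITIONAL;
* §3 `natCard_sha_two_mul_pow_rank_eq` — the descent count then reads `#Ш(E_N)[2] · 2^{rk} = 2^{s}`
  (Silverman X.4.2 with `#E_N(ℚ)[2] = 4`);
* §4 **the parity of the rank, granting the Cassels–Tate pairing and the finiteness of `Ш(E_N)[2^∞]`**
  (Heath-Brown §1 p. 3 L16–L24: "this parity condition … can in fact be derived from results of
  Cassels [4] and Birch and Stephens [1]"; here read in the other direction): with the tree's named
  fact `WeierstrassCurve.exists_casselsTate_pairing` (bsd.S18) and `Ш(E_N)[2^∞]` finite, `#Ш(E_N)[2]`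
  is a square (`CasselsTateParity`), so **`rk E_N(ℚ) ≡ s (mod 2)`: the rank is even iff
  `N ≡ 1, 2, 3 (mod 8)`** (`even_mordellWeilRank_iff_of_casselsTate`), and **every square-free
  `N ≡ 5, 6, 7 (mod 8)` has odd, hence positive, rank and is a congruent number**
  (`isCongruentNumber_of_casselsTate_of_finite_sha`; "`D` is congruent iff `E_D` has positive rank",
  Heath-Brown p. 1 L6–L10).  The hypotheses are explicit binders; nothing is asserted about them.

Cell `bsd-monsky` (prover-B).  AI provenance: written by an AI assistant; no human has reviewed it.

## References

* [HeathBrown1994SelmerCongruentII] D. R. Heath-Brown, Invent. Math. 118 (1994) 331–370: §1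
  typescript p. 1 L6–L20 (congruent numbers, `#S⁽²⁾ = 2^{2+s(D)}`, `r(D) ≤ s(D)`), p. 3 L13–L24 (the
  parity condition and its derivation from Cassels and Birch–Stephens); Appendix (P. Monsky),
  Theorem p. 38 L5–L7.
* [SilvermanAEC2009] J. H. Silverman, *The Arithmetic of Elliptic Curves*, 2nd ed., Thm. X.4.2,
  Thm. X.4.14 (Cassels–Tate pairing).
-/

noncomputable section

open WeierstrassCurve Finset
open Literature.NumberTheory.EllipticCurves.HeathBrown1994

namespace Literature.NumberTheory.EllipticCurves

namespace MonskySelmerParity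

/-! ## §1 A square-free integer as an injective family of primes -/

/-- A square-free `N` is the product of an injective family of primes `p : Fin k → ℕ`
("`p₁, …, p_n` are the primes dividing `D`", `n = Ω(D)`).
[cite: HeathBrown1994SelmerCongruentII, Appendix (Monsky), typescript p. 38 L28 and p. 39 L7–L8] -/
theorem exists_prime_family_of_squarefree {N : ℕ} (hN : Squarefree N) :
    ∃ (k : ℕ) (p : Fin k → ℕ), (∀ i, (p i).Prime) ∧ Function.Injective p ∧ ∏ i, p i = N := by
  refine ⟨N.primeFactors.card, fun i => ((N.primeFactors.equivFin.symm i : N.primeFactors) : ℕ),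
    fun i => Nat.prime_of_mem_primeFactors (N.primeFactors.equivFin.symm i).2,
    fun i j h => N.primeFactors.equivFin.symm.injective (Subtype.ext h), ?_⟩
  calc ∏ i, ((N.primeFactors.equivFin.symm i : N.primeFactors) : ℕ)
      = ∏ q : N.primeFactors, (q : ℕ) :=
        (Fintype.prod_equiv N.primeFactors.equivFin.symm _ _ fun _ => rfl)
    _ = ∏ q ∈ N.primeFactors, q := Finset.prod_coe_sort N.primeFactors (fun q : ℕ => q)
    _ = N := Nat.prod_primeFactors_of_squarefree hN

/-- An odd square-free `N` is the product of an injective family of ODD primes.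
[cite: HeathBrown1994SelmerCongruentII, Appendix (Monsky), typescript p. 38 L6 and p. 39 L7–L8] -/
theorem exists_odd_prime_family_of_squarefree {N : ℕ} (hN : Squarefree N) (hodd : Odd N) :
    ∃ (k : ℕ) (p : Fin k → ℕ), (∀ i, (p i).Prime) ∧ (∀ i, p i ≠ 2) ∧ Function.Injective p ∧
      ∏ i, p i = N := by
  obtain ⟨k, p, hp, hinj, hprod⟩ := exists_prime_family_of_squarefree hN
  refine ⟨k, p, hp, fun i h2 => ?_, hinj, hprod⟩
  have hdvd : 2 ∣ N := by
    rw [← hprod, ← h2]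
    exact Finset.dvd_prod_of_mem p (Finset.mem_univ i)
  exact (Nat.not_even_iff_odd.mpr hodd) (even_iff_two_dvd.mpr hdvd)

/-- An even square-free `N` is `2 · p₁⋯p_k` for an injective family of odd primes ("`D₀ = D/2`").
[cite: HeathBrown1994SelmerCongruentII, Appendix (Monsky), typescript p. 40 L43 – p. 41 L1] -/
theorem exists_odd_prime_family_of_squarefree_even {N : ℕ} (hN : Squarefree N) (heven : Even N) :
    ∃ (k : ℕ) (p : Fin k → ℕ), (∀ i, (p i).Prime) ∧ (∀ i, p i ≠ 2) ∧ Function.Injective p ∧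
      2 * ∏ i, p i = N := by
  obtain ⟨M, hM⟩ := even_iff_two_dvd.mp heven
  have hN2 : Squarefree (2 * M) := hM ▸ hN
  have hM' : Squarefree M := hN2.of_mul_right
  have hModd : Odd M := by
    refine Nat.odd_iff.mpr ?_
    by_contra h2
    have h4 : 2 * 2 ∣ 2 * M := Nat.mul_dvd_mul_left 2 (Nat.dvd_of_mod_eq_zero (by omega))
    exact absurd (Nat.isUnit_iff.mp (hN2 2 h4)) (by norm_num)
  obtain ⟨k, p, hp, hp2, hinj, hprod⟩ := exists_odd_prime_family_of_squarefree hM' hModd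
  exact ⟨k, p, hp, hp2, hinj, by rw [hprod, hM]⟩

/-! ## §2 The parity condition for `#Sel⁽²⁾(E_N/ℚ) = 2^{2+s}` -/

/-- **The parity condition, odd square-free `N`** (Heath-Brown §1 p. 3 L13–L16 with the appendix's
Theorem and the `2`-Selmer formula): there is `s` — Monsky's `s(N)` — with `#Sel⁽²⁾(E_N/ℚ) = 2^{2+s}`,
`rk E_N(ℚ) ≤ s`, and `s` even iff `N ≡ 1, 3 (mod 8)`.  Unconditional.
[cite: HeathBrown1994SelmerCongruentII, §1 typescript p. 1 L14–L20 and p. 3 L13–L16; Appendix (Monsky) Theorem p. 38 L5–L7] -/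
theorem exists_card_selmerGroup_two_eq_pow_odd {N : ℕ} (hN : Squarefree N) (hodd : Odd N) :
    ∃ s : ℕ, Nat.card ((congruentNumberCurve N).selmerGroup 2) = 2 ^ (2 + s) ∧
      (haveI := isElliptic_congruentNumberCurve hN.ne_zero; (congruentNumberCurve N).mordellWeilRank ≤ s) ∧
      (Even s ↔ N % 8 = 1 ∨ N % 8 = 3) := by
  obtain ⟨k, p, hp, hp2, hinj, rfl⟩ := exists_odd_prime_family_of_squarefree hN hodd
  have hodd' : ∀ i, Odd (p i) := fun i => (hp i).odd_of_ne_two (hp2 i)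
  exact ⟨monskySelmerRankOdd p, monsky_card_selmerGroup_two_odd_holds k p hp hodd' hinj,
    CongruentNumberMonskySelmer.mordellWeilRank_le_monskySelmerRankOdd p hp hodd' hinj,
    even_monskySelmerRankOdd_iff p hp hp2 hinj⟩

/-- **The parity condition, even square-free `N`**: there is `s` with `#Sel⁽²⁾(E_N/ℚ) = 2^{2+s}`,
`rk E_N(ℚ) ≤ s`, and `s` even iff `N ≡ 2 (mod 8)`.  Unconditional.
[cite: HeathBrown1994SelmerCongruentII, §1 typescript p. 1 L14–L20; Appendix (Monsky) Theorem p. 38 L5–L7 and p. 41 L20–L36] -/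
theorem exists_card_selmerGroup_two_eq_pow_even {N : ℕ} (hN : Squarefree N) (heven : Even N) :
    ∃ s : ℕ, Nat.card ((congruentNumberCurve N).selmerGroup 2) = 2 ^ (2 + s) ∧
      (haveI := isElliptic_congruentNumberCurve hN.ne_zero; (congruentNumberCurve N).mordellWeilRank ≤ s) ∧
      (Even s ↔ N % 8 = 2) := by
  obtain ⟨k, p, hp, hp2, hinj, rfl⟩ := exists_odd_prime_family_of_squarefree_even hN heven
  have hodd' : ∀ i, Odd (p i) := fun i => (hp i).odd_of_ne_two (hp2 i)
  exact ⟨monskySelmerRankEven p, monsky_card_selmerGroup_two_even_holds k p hp hodd' hinj,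
    CongruentNumberMonskySelmer.mordellWeilRank_le_monskySelmerRankEven p hp hodd' hinj,
    even_monskySelmerRankEven_iff_mod_eight p hp hp2 hinj⟩

/-- **The parity condition for every square-free `N`** (Heath-Brown 1994 §1 / Monsky's appendix):
`#Sel⁽²⁾(E_N/ℚ) = 2^{2+s}` with `rk E_N(ℚ) ≤ s` and **`s` even iff `N ≡ 1, 2, 3 (mod 8)`** (odd iff
`N ≡ 5, 6, 7 (mod 8)`).  Unconditional; every number of prime factors.
[cite: HeathBrown1994SelmerCongruentII, §1 typescript p. 3 L13–L16; Appendix (Monsky) Theorem p. 38 L5–L7] -/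
theorem exists_card_selmerGroup_two_eq_pow {N : ℕ} (hN : Squarefree N) :
    ∃ s : ℕ, Nat.card ((congruentNumberCurve N).selmerGroup 2) = 2 ^ (2 + s) ∧
      (haveI := isElliptic_congruentNumberCurve hN.ne_zero; (congruentNumberCurve N).mordellWeilRank ≤ s) ∧
      (Even s ↔ N % 8 = 1 ∨ N % 8 = 2 ∨ N % 8 = 3) := by
  rcases Nat.even_or_odd N with heven | hodd
  · obtain ⟨s, h1, h2, h3⟩ := exists_card_selmerGroup_two_eq_pow_even hN heven
    have h2N : N % 2 = 0 := Nat.even_iff.mp heven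
    exact ⟨s, h1, h2, by rw [h3]; omega⟩
  · obtain ⟨s, h1, h2, h3⟩ := exists_card_selmerGroup_two_eq_pow_odd hN hodd
    have h2N : N % 2 = 1 := Nat.odd_iff.mp hodd
    exact ⟨s, h1, h2, by rw [h3]; omega⟩

/-- **`#Sel⁽²⁾(E_N/ℚ) ≥ 8` for square-free `N ≡ 5, 6, 7 (mod 8)`**: `s` is odd, so `s ≥ 1`.
[cite: HeathBrown1994SelmerCongruentII, §1 typescript p. 3 L13–L16] -/
theorem eight_le_card_selmerGroup_two {N : ℕ} (hN : Squarefree N) (h8 : N % 8 = 5 ∨ N % 8 = 6 ∨ N % 8 = 7) :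
    8 ≤ Nat.card ((congruentNumberCurve N).selmerGroup 2) := by
  obtain ⟨s, h1, -, h3⟩ := exists_card_selmerGroup_two_eq_pow hN
  have hs : ¬ Even s := fun hs => by have := h3.mp hs; omega
  have hs1 : 1 ≤ s := by
    rcases Nat.even_or_odd s with h | h
    · exact absurd h hs
    · exact h.pos
  rw [h1]
  calc 8 = 2 ^ (2 + 1) := by norm_num
    _ ≤ 2 ^ (2 + s) := Nat.pow_le_pow_right (by norm_num) (by omega)

/-! ## §3 The descent count: `#Ш(E_N)[2] · 2^{rk} = 2^{s}` -/

/-- **`#Ш(E_N)[2] · 2^{rk E_N(ℚ)} = 2^{s}`** whenever `#Sel⁽²⁾(E_N/ℚ) = 2^{2+s}`: the descent count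
`#Sel₂ = 2^{rk}·#E_N(ℚ)[2]·#(Ш ⊓ H¹[2])` (Silverman X.4.2) with `#E_N(ℚ)[2] = 4`.
[cite: SilvermanAEC2009, Thm. X.4.2] [cite: HeathBrown1994SelmerCongruentII, §1 typescript p. 1 L14–L20] -/
theorem natCard_sha_two_mul_pow_rank_eq {N : ℕ} (hN : N ≠ 0) {s : ℕ}
    (hs : Nat.card ((congruentNumberCurve N).selmerGroup 2) = 2 ^ (2 + s)) :
    haveI := isElliptic_congruentNumberCurve hN
    Nat.card ((congruentNumberCurve N).sha ⊓ AddSubgroup.torsionBy (congruentNumberCurve N).galH1 2 :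
        AddSubgroup (congruentNumberCurve N).galH1) * 2 ^ (congruentNumberCurve N).mordellWeilRank = 2 ^ s := by
  haveI := isElliptic_congruentNumberCurve hN
  have hcard := (congruentNumberCurve N).natCard_selmerGroup_eq (n := 2) two_ne_zero
  have hs' : Nat.card ((congruentNumberCurve N).selmerGroup ((2 : ℕ) : ℤ)) = 2 ^ (2 + s) := by
    simpa only [Nat.cast_ofNat] using hs
  -- `2^r · 4 · S = 4 · 2^s`
  have key : ∀ {C R T S : ℕ}, C = 2 ^ R * T * S → T = 4 → C = 2 ^ (2 + s) → S * 2 ^ R = 2 ^ s := by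
    intro C R T S hC hT hCs
    subst hT
    rw [hCs, pow_add, show (2 : ℕ) ^ 2 = 4 by norm_num] at hC
    have h' : 4 * (S * 2 ^ R) = 4 * 2 ^ s := by linarith [hC]
    exact Nat.eq_of_mul_eq_mul_left (by norm_num) h'
  have h := key hcard (by convert Smith2016.natCard_torsionBy_two_congruentNumberCurve hN; norm_num) hs'
  simpa only [Nat.cast_ofNat] using h

/-! ## §4 Granting Cassels–Tate and `Ш(E_N)[2^∞]` finite: `#Ш(E_N)[2]` is a square, and the rank has the parity of `s` -/

/-- **`#Ш(E)[2]` is a square when `Ш(E)[2^∞]` is finite**, granting the Cassels–Tate pairing (`hCT`,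
the tree's named fact bsd.S18): for the finite group `A = Ш[2^∞]`, `#A[2] = #(A/2A)` and
`#(A/2A) = 2^{2m}` (`CasselsTateParity.exists_natCard_modN_primaryComponent_sha`); `A[2] = Ш[2]`.
Stated for the subgroup `Ш ⊓ H¹(ℚ, E)[2]` of the descent count.
[cite: SilvermanAEC2009, Thm. X.4.14] [cite: HeathBrown1994SelmerCongruentII, §1 typescript p. 3 L16–L20] -/
theorem exists_natCard_sha_two_eq_pow_two_mul (W : WeierstrassCurve ℚ) [W.IsElliptic]
    (hCT : exists_casselsTate_pairing (K := ℚ))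
    (hfin : Finite (AddCommGroup.primaryComponent W.sha 2)) :
    ∃ m : ℕ, Nat.card (W.sha ⊓ AddSubgroup.torsionBy W.galH1 2 : AddSubgroup W.galH1) = 2 ^ (2 * m) := by
  haveI : Fact (Nat.Prime 2) := ⟨Nat.prime_two⟩
  haveI := hfin
  obtain ⟨m, hm⟩ := exists_natCard_modN_primaryComponent_sha W 2 hCT
  refine ⟨m, ?_⟩
  rw [← hm, ← Literature.GroupTheory.FiniteAbelian.natCard_torsionBy_eq_natCard_modN,
    Literature.Algebra.Module.natCard_torsionBy_primaryComponent,
    Literature.Algebra.Module.natCard_torsionBy_addSubgroup]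
  rfl

/-- **Granting Cassels–Tate and `Ш(E_N)[2^∞]` finite, `rk E_N(ℚ) ≡ s (mod 2)`** for every square-free
`N`: the rank is even iff `N ≡ 1, 2, 3 (mod 8)` — the parity condition for `s(D)` (Monsky's theorem)
transferred to the rank through `#Ш[2]·2^{rk} = 2^{s}` with `#Ш[2]` a square.  Heath-Brown §1
p. 3 L16–L24 runs this deduction in the opposite direction ("derived from results of Cassels [4] and
Birch and Stephens [1]"). The two hypotheses are explicit; nothing is asserted about them.
[cite: HeathBrown1994SelmerCongruentII, §1 typescript p. 3 L13–L24; Appendix (Monsky) Theorem p. 38 L5–L7] -/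
theorem even_mordellWeilRank_iff_of_casselsTate {N : ℕ} (hN : Squarefree N)
    (hCT : exists_casselsTate_pairing (K := ℚ))
    (hfin : haveI := isElliptic_congruentNumberCurve hN.ne_zero;
      Finite (AddCommGroup.primaryComponent (congruentNumberCurve N).sha 2)) :
    haveI := isElliptic_congruentNumberCurve hN.ne_zero
    Even (congruentNumberCurve N).mordellWeilRank ↔ N % 8 = 1 ∨ N % 8 = 2 ∨ N % 8 = 3 := by
  haveI := isElliptic_congruentNumberCurve hN.ne_zero
  obtain ⟨s, hs, -, hpar⟩ := exists_card_selmerGroup_two_eq_pow hN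
  obtain ⟨m, hm⟩ := exists_natCard_sha_two_eq_pow_two_mul (congruentNumberCurve N) hCT hfin
  have hcount := natCard_sha_two_mul_pow_rank_eq hN.ne_zero hs
  rw [hm, ← pow_add] at hcount
  have hexp : 2 * m + (congruentNumberCurve N).mordellWeilRank = s :=
    Nat.pow_right_injective (le_refl 2) hcount
  rw [← hpar, ← hexp, Nat.even_add]
  simp

/-- **Granting Cassels–Tate and `Ш(E_N)[2^∞]` finite, every square-free `N ≡ 5, 6, 7 (mod 8)` has ODD
rank** (in particular rank `≥ 1`). [cite: HeathBrown1994SelmerCongruentII, §1 typescript p. 3 L13–L24] -/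
theorem odd_mordellWeilRank_of_casselsTate {N : ℕ} (hN : Squarefree N)
    (h8 : N % 8 = 5 ∨ N % 8 = 6 ∨ N % 8 = 7) (hCT : exists_casselsTate_pairing (K := ℚ))
    (hfin : haveI := isElliptic_congruentNumberCurve hN.ne_zero;
      Finite (AddCommGroup.primaryComponent (congruentNumberCurve N).sha 2)) :
    haveI := isElliptic_congruentNumberCurve hN.ne_zero
    Odd (congruentNumberCurve N).mordellWeilRank := by
  rw [← Nat.not_even_iff_odd, even_mordellWeilRank_iff_of_casselsTate hN hCT hfin]
  omega

/-- **Granting Cassels–Tate and the finiteness of `Ш(E_N)[2^∞]`, every square-free `N ≡ 5, 6, 7 (mod 8)`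
is a congruent number**: its rank is odd, hence positive, and "`D` is a congruent number" iff `E_D`
has positive rank (Heath-Brown p. 1 L6–L10; tree: `isCongruentNumber_of_mordellWeilRank_ne_zero`).
The classical conditional corollary of the parity of `s(D)`; both hypotheses explicit.
[cite: HeathBrown1994SelmerCongruentII, §1 typescript p. 1 L6–L10 and p. 3 L13–L24] -/
theorem isCongruentNumber_of_casselsTate_of_finite_sha {N : ℕ} (hN : Squarefree N)
    (h8 : N % 8 = 5 ∨ N % 8 = 6 ∨ N % 8 = 7) (hCT : exists_casselsTate_pairing (K := ℚ))
    (hfin : haveI := isElliptic_congruentNumberCurve hN.ne_zero;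
      Finite (AddCommGroup.primaryComponent (congruentNumberCurve N).sha 2)) :
    IsCongruentNumber N :=
  isCongruentNumber_of_mordellWeilRank_ne_zero hN.ne_zero
    (odd_mordellWeilRank_of_casselsTate hN h8 hCT hfin).pos.ne'

/-- The same with the (stronger) hypothesis that the whole of `Ш(E_N)` is finite.
[cite: HeathBrown1994SelmerCongruentII, §1 typescript p. 1 L6–L10 and p. 3 L13–L24] -/
theorem isCongruentNumber_of_casselsTate_of_finite_sha' {N : ℕ} (hN : Squarefree N)
    (h8 : N % 8 = 5 ∨ N % 8 = 6 ∨ N % 8 = 7) (hCT : exists_casselsTate_pairing (K := ℚ))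
    (hfin : haveI := isElliptic_congruentNumberCurve hN.ne_zero; Finite (congruentNumberCurve N).sha) :
    IsCongruentNumber N := by
  haveI := isElliptic_congruentNumberCurve hN.ne_zero
  haveI := hfin
  exact isCongruentNumber_of_casselsTate_of_finite_sha hN h8 hCT inferInstance

end MonskySelmerParity

end Literature.NumberTheory.EllipticCurves

end
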